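import Literature.Geometry.Kaehler.RiemannSurfaceChevalleyWeilBranchValues
import HarnessLib

/-!
# Fixed points sorted by rotation number: `|Fix_ζ(g)| = |C_G(g)|·Σ_t 1/m_t` and Eichler's formula in terms of
# the branch data (Frediani–Ghigi–Penegini Lemma 2.5, Corollary 2.8)

Layer `Literature/Geometry/Kaehler`, sequel of `RiemannSurfaceChevalleyWeilBranchValues` (`a_{g•P}(ghg⁻¹) = a_P(h)`:
the rotation character is a conjugation invariant) and `RiemannSurfaceEichlerTraceFormula` (V.2.9). For a finite
group `G ≤ Aut M` the fixed points of `g ∈ G` lie over the branch values `q_t` of `π : M → M/G`; over `q_t` the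
fibre is `G/G_{P_t}` (`P_t` a point over `q_t`, `G_{P_t}` cyclic of order `m_t` with the injective rotation character
`a_{P_t}`), `g` fixes `x•P_t` iff `x⁻¹gx ∈ G_{P_t}`, and then `a_{x•P_t}(g) = a_{P_t}(x⁻¹gx)`. P. Frediani, A. Ghigi,
M. Penegini, *Shimura varieties in the Torelli locus via Galois coverings*, IMRN 2015, as printed (arXiv copy p. 13;
`x_i` generates the stabilizer over the `i`-th branch value, normalised by `ζ_{P}(x_i) = ζ_{m_i}`):

> Denote by `Fix(g)` the set of fixed points of `g`. For `ν ∈ I(m)` set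
> `Fix_ν(g) := {P ∈ C : gP = P, ζ_P(g) = ζ_m^ν}`.
> **Lemma 2.5.** If `G ⊆ Aut(C)` and `g ∈ G` has order `m`, then
> `|Fix_ν(g)| = |C_G(g)| · Σ_{1 ≤ i ≤ r, m | m_i, g ∼_G x_i^{m_i ν/m}} 1/m_i`.
> (Here `C_G(g)` denotes the centralizer of `g` in `G` and `∼_G` denotes the equivalence relation given by
> conjugation in `G`.) This lemma follows from [19, Theorem 7], see also [4, Lemma 11.5].
> **Theorem 2.7** (Eichler Trace Formula). […] `χ_ρ(g) = Tr(ρ(g)) = 1 + Σ_{P ∈ Fix(g)} ζ_P(g)/(1 − ζ_P(g))` […]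
> Collecting the terms with equal exponent and using the previous lemma one gets the following.
> **Corollary 2.8.** `χ_ρ(g) = 1 + |C_G(g)| Σ_{ν ∈ I(m)} {Σ_{1 ≤ i ≤ r, m | m_i, g ∼_G x_i^{m_iν/m}} 1/m_i} ζ_m^ν/(1 − ζ_m^ν)`.

THE FORM PROVED HERE (coordinate-free: no global root of unity `ζ_m = e^{2πi/m}` is chosen; the condition
«`m | m_i` and `g ∼_G x_i^{m_iν/m}`» says that the unique element of `G_{P_i}` with rotation number `ζ_m^ν` is
conjugate to `g`). For `g ≠ 1` and EVERY function `F` of the rotation number,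

  `Σ_{P ∈ Fix g} F(a_P(g)) = |C_G(g)| · Σ_{q ∈ Br} r_q⁻¹ · Σ_{y ∈ G_{q.out}, y ∼_G g} F(a_{q.out}(y))`

(`sum_fixedBy_eq_card_centralizer_mul_sum_branch`); with `F = 𝟙_{ζ}`: **Lemma 2.5**
`|{P : gP = P, a_P(g) = ζ}| = |C_G(g)| · Σ_{q ∈ Br : ∃ y ∈ G_{q.out}, y ∼_G g, a_{q.out}(y) = ζ} 1/r_q`; with `F = 1`:
`|Fix g| = |C_G(g)| Σ_q #{y ∈ G_{q.out} : y ∼ g}/r_q`; with `F(z) = z⁻¹/(1 − z⁻¹)` and the tree's Eichler formula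
(`tr g = 1 + Σ_{P ∈ Fix g} a_P(g⁻¹)/(1 − a_P(g⁻¹))`, action `Tφ = (T⁻¹)^*φ`): **Corollary 2.8**.

## What is formalized (everything proved; no definitions, no named facts, no instances)

* §1 (group theory) `card_filter_inv_mul_mul_eq`, `card_filter_inv_mul_mul_eq_ite`
  (`#{x : x⁻¹gx = y} = |C_G(g)|·[g ∼ y]`), `sum_filter_inv_mul_mul_mem_eq`;
* §2 `stabDeriv_smul_eq_stabDeriv_inv_mul_mul` (`a_{x•P₀}(g) = a_{P₀}(x⁻¹gx)`), `stabOrder_mul_sum_filter_fixedBy_eq`,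
  **`stabOrder_mul_sum_filter_fixedBy_eq_card_centralizer_mul`** (one fibre);
* §3 **`sum_fixedBy_eq_card_centralizer_mul_sum_branch`**, **`card_fixedBy_stabDeriv_eq`** (Lemma 2.5),
  `ncard_fixedBy_eq_card_centralizer_mul_sum` (`|Fix g|`), **`trace_oneFormRep_eq_one_add_card_centralizer_mul_sum`**
  (Corollary 2.8).

## References

* P. Frediani, A. Ghigi, M. Penegini, *Shimura varieties in the Torelli locus via Galois coverings*, Int. Math. Res.
  Not. IMRN 2015, no. 20, 10595–10623, §2.5, Lemma 2.5, Theorem 2.7, Corollary 2.8 (arXiv:1402.0973 p. 13); their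
  sources: W. J. Harvey, *On branch loci in Teichmüller space*, Trans. AMS 153 (1971), Theorem 7; T. Breuer,
  *Characters and automorphism groups of compact Riemann surfaces*, LMS LNS 280 (2000), Lemma 11.5.
  [FredianiGhigiPenegini2015]
* H. M. Farkas, I. Kra, *Riemann Surfaces*, GTM 71, 2nd ed. (1992), V.2.9. [FarkasKra1992]
* R. Miranda, *Algebraic Curves and Riemann Surfaces*, GSM 5 (1995), Chapter III Proposition 3.1, Lemma 3.6. [Miranda1995]
* H. Lange, R. E. Rodríguez, *Decomposition of Jacobians by Prym Varieties*, LNM 2310 (2022), Theorem 3.1.6 (proof). [LangeRodriguez2022]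
-/

noncomputable section

open scoped Manifold ContDiff Topology
open Set Filter Function Complex MulAction Module

namespace Literature.Geometry.Kaehler

namespace RiemannSurface

/-! ### §1 Group theory: `#{x ∈ G : x⁻¹ g x = y} = |C_G(g)|·[g ∼ y]` -/

section GroupTheory

variable {Γ : Type*} [Group Γ] [Fintype Γ] [DecidableEq Γ]

/-- The solutions of `x⁻¹ g x = x₀⁻¹ g x₀` form the coset `C_Γ(g)·x₀`: there are `|C_Γ(g)|` of them. [folklore]
[cite: FredianiGhigiPenegini2015, Lemma 2.5 (proof sketch: «follows from [19, Theorem 7]»)] -/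
theorem card_filter_inv_mul_mul_eq (g x₀ : Γ) :
    (Finset.univ.filter fun x : Γ ↦ x⁻¹ * g * x = x₀⁻¹ * g * x₀).card = Nat.card (Subgroup.centralizer {g}) := by
  classical
  rw [Nat.card_eq_fintype_card, ← Fintype.card_coe]
  refine Fintype.card_congr (Equiv.subtypeEquiv (Equiv.mulRight x₀⁻¹) fun x ↦ ?_)
  simp only [Finset.mem_filter, Finset.mem_univ, true_and, Equiv.coe_mulRight,
    Subgroup.mem_centralizer_iff, Set.mem_singleton_iff, forall_eq]
  constructor
  · intro h
    calc g * (x * x₀⁻¹) = x * (x⁻¹ * g * x) * x₀⁻¹ := by group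
      _ = x * (x₀⁻¹ * g * x₀) * x₀⁻¹ := by rw [h]
      _ = x * x₀⁻¹ * g := by group
  · intro h
    calc x⁻¹ * g * x = x⁻¹ * (g * (x * x₀⁻¹)) * x₀ := by group
      _ = x⁻¹ * (x * x₀⁻¹ * g) * x₀ := by rw [h]
      _ = x₀⁻¹ * g * x₀ := by group

open Classical in
/-- **`#{x ∈ Γ : x⁻¹ g x = y} = |C_Γ(g)|` if `y` is conjugate to `g`, and `0` otherwise.** [folklore]
[cite: FredianiGhigiPenegini2015, Lemma 2.5] -/
theorem card_filter_inv_mul_mul_eq_ite (g y : Γ) :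
    (Finset.univ.filter fun x : Γ ↦ x⁻¹ * g * x = y).card =
      if IsConj g y then Nat.card (Subgroup.centralizer {g}) else 0 := by
  split_ifs with hc
  · obtain ⟨c, hc⟩ := isConj_iff.1 hc
    have hy : y = (c⁻¹)⁻¹ * g * c⁻¹ := by rw [inv_inv, ← hc]
    rw [hy, card_filter_inv_mul_mul_eq]
  · rw [Finset.card_eq_zero, Finset.filter_eq_empty_iff]
    intro x _ hx
    exact hc (isConj_iff.2 ⟨x⁻¹, by rw [inv_inv]; exact hx⟩)

open Classical in
/-- **Summing over conjugates: `Σ_{x ∈ Γ} F(x⁻¹ g x)·[x⁻¹ g x ∈ S] = |C_Γ(g)|·Σ_{y ∈ S, y ∼ g} F(y)`.** [folklore]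
[cite: FredianiGhigiPenegini2015, Lemma 2.5] -/
theorem sum_filter_inv_mul_mul_mem_eq {R : Type*} [CommRing R] (g : Γ) (S : Finset Γ) (F : Γ → R) :
    ∑ x ∈ Finset.univ.filter (fun x : Γ ↦ x⁻¹ * g * x ∈ S), F (x⁻¹ * g * x) =
      Nat.card (Subgroup.centralizer {g}) * ∑ y ∈ S.filter (fun y ↦ IsConj g y), F y := by
  rw [← Finset.sum_fiberwise_of_maps_to (g := fun x : Γ ↦ x⁻¹ * g * x) (t := S)
    (fun x hx ↦ (Finset.mem_filter.1 hx).2), Finset.sum_filter, Finset.mul_sum]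
  refine Finset.sum_congr rfl fun y hy ↦ ?_
  have h1 : ∑ x ∈ (Finset.univ.filter (fun x : Γ ↦ x⁻¹ * g * x ∈ S)).filter (fun x ↦ x⁻¹ * g * x = y),
      F (x⁻¹ * g * x) = ∑ x ∈ Finset.univ.filter (fun x : Γ ↦ x⁻¹ * g * x = y), F y := by
    rw [Finset.filter_filter]
    refine Finset.sum_congr (Finset.filter_congr fun x _ ↦ ⟨fun h ↦ h.2, fun h ↦ ⟨h ▸ hy, h⟩⟩) fun x hx ↦ ?_
    rw [(Finset.mem_filter.1 hx).2]
  rw [h1, Finset.sum_const, nsmul_eq_mul, card_filter_inv_mul_mul_eq_ite]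
  split_ifs with hc
  · rfl
  · rw [Nat.cast_zero, zero_mul, mul_zero]

end GroupTheory

/-! ### §2 Fixed points of `g` over one branch value -/

section Fibre

variable {M : Type*} [TopologicalSpace M] [ChartedSpace ℂ M] [IsManifold 𝓘(ℂ, ℂ) ω M]
  [CompactSpace M] [T2Space M] [PreconnectedSpace M] [Nonempty M] [Finite (autGroup M)]
  (G : Subgroup (autGroup M))

open OrbitSurface

omit [CompactSpace M] [Nonempty M] [Finite ↥(autGroup M)] [T2Space M] [PreconnectedSpace M] in
/-- **The rotation number of `g` at `x•P₀` is that of `x⁻¹ g x` at `P₀`**: `a_{x•P₀}(g) = a_{P₀}(x⁻¹ g x)` when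
`x⁻¹ g x ∈ G_{P₀}`. [cite: FredianiGhigiPenegini2015, §2.5 («the cyclic subgroups `⟨x_i⟩` and their conjugates are
the non-trivial stabilizers»)] [cite: LangeRodriguez2022, Theorem 3.1.6 (proof)] -/
theorem stabDeriv_smul_eq_stabDeriv_inv_mul_mul (g x : ↥G) {P₀ : M} (h : (x⁻¹ * g * x) • P₀ = P₀) :
    stabDeriv (x • P₀) g = stabDeriv P₀ (x⁻¹ * g * x) := by
  have h1 := stabDeriv_conj hhol_of_holomorphicSMul x h (M := M)
  rwa [show x * (x⁻¹ * g * x) * x⁻¹ = g by group] at h1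

omit [CompactSpace M] [T2Space M] [PreconnectedSpace M] [Nonempty M] [Finite ↥(autGroup M)] in
open Classical in
/-- **Over a point `q` of `M/G` (`P₀ = q.out`, `r_q = |G_{P₀}|`):
`r_q · Σ_{P ∈ π⁻¹(q), gP = P} F(a_P(g)) = Σ_{x ∈ G : x⁻¹gx ∈ G_{P₀}} F(a_{P₀}(x⁻¹ g x))`** (the fibre is `G/G_{P₀}`,
`g` fixes `x•P₀` iff `x⁻¹gx ∈ G_{P₀}`, with rotation number `a_{P₀}(x⁻¹gx)`). [cite: FredianiGhigiPenegini2015, Lemma 2.5]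
[cite: Miranda1995, Chapter III Lemma 3.6] -/
theorem stabOrder_mul_sum_filter_fixedBy_eq [Fintype ↥G] [DecidableEq ↥G] {R : Type*} [CommRing R] (g : ↥G)
    (q : OrbitSurface G M) (F : ℂ → R) (s : Finset M) (hs : ∀ P, mk G P = q → g • P = P → P ∈ s) :
    (stabOrder q : R) * ∑ P ∈ s.filter (fun P ↦ mk G P = q ∧ g • P = P), F (stabDeriv P g) =
      ∑ x ∈ Finset.univ.filter (fun x : ↥G ↦ (x⁻¹ * g * x) • q.out = q.out), F (stabDeriv q.out (x⁻¹ * g * x)) := by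
  set P₀ := q.out with hP₀
  -- rewrite the right side as a sum over the whole group of a function of `x • P₀`
  have h1 : ∑ x ∈ Finset.univ.filter (fun x : ↥G ↦ (x⁻¹ * g * x) • P₀ = P₀), F (stabDeriv P₀ (x⁻¹ * g * x)) =
      ∑ x : ↥G, (if g • (x • P₀) = x • P₀ then F (stabDeriv (x • P₀) g) else 0) := by
    rw [Finset.sum_filter]
    refine Finset.sum_congr rfl fun x _ ↦ ?_
    have hiff : (x⁻¹ * g * x) • P₀ = P₀ ↔ g • (x • P₀) = x • P₀ := by
      rw [mul_smul, mul_smul, inv_smul_eq_iff]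
    by_cases hx : (x⁻¹ * g * x) • P₀ = P₀
    · rw [if_pos hx, if_pos (hiff.1 hx), stabDeriv_smul_eq_stabDeriv_inv_mul_mul G g x hx]
    · rw [if_neg hx, if_neg (fun h ↦ hx (hiff.2 h))]
  rw [h1, sum_smul_eq_card_stabilizer_mul_sum_orbit P₀ (fun P ↦ if g • P = P then F (stabDeriv P g) else 0),
    ← Finset.sum_filter]
  -- `stabOrder q = |G_{P₀}|` by definition
  change (Nat.card (stabilizer G P₀) : R) * _ = (Nat.card (stabilizer G P₀) : R) * _
  congr 1
  refine Finset.sum_congr ?_ fun P _ ↦ rfl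
  ext P
  simp only [Finset.mem_filter, Finset.mem_image, Finset.mem_univ, true_and]
  constructor
  · rintro ⟨-, hPq, hgP⟩
    refine ⟨mk_eq_mk_iff.1 (by rw [hP₀, mk_out, hPq]), hgP⟩
  · rintro ⟨⟨x, rfl⟩, hgP⟩
    have hq : mk G (x • P₀) = q := by rw [mk_smul, hP₀, mk_out]
    exact ⟨hs _ hq hgP, hq, hgP⟩

omit [CompactSpace M] [T2Space M] [PreconnectedSpace M] [Nonempty M] [Finite ↥(autGroup M)] in
open Classical in
/-- **Over a point `q` of `M/G`: `r_q · Σ_{P ∈ π⁻¹(q), gP = P} F(a_P(g)) = |C_G(g)| · Σ_{y ∈ G_{P₀}, y ∼ g} F(a_{P₀}(y))`.**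
[cite: FredianiGhigiPenegini2015, Lemma 2.5] -/
theorem stabOrder_mul_sum_filter_fixedBy_eq_card_centralizer_mul [Fintype ↥G] [DecidableEq ↥G] {R : Type*}
    [CommRing R] (g : ↥G) (q : OrbitSurface G M) (F : ℂ → R) (s : Finset M)
    (hs : ∀ P, mk G P = q → g • P = P → P ∈ s) :
    (stabOrder q : R) * ∑ P ∈ s.filter (fun P ↦ mk G P = q ∧ g • P = P), F (stabDeriv P g) =
      Nat.card (Subgroup.centralizer {g}) *
        ∑ y ∈ Finset.univ.filter (fun y : ↥G ↦ y • q.out = q.out ∧ IsConj g y), F (stabDeriv q.out y) := by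
  rw [stabOrder_mul_sum_filter_fixedBy_eq G g q F s hs]
  have h1 := sum_filter_inv_mul_mul_mem_eq g (Finset.univ.filter fun y : ↥G ↦ y • q.out = q.out)
    (fun y ↦ F (stabDeriv q.out y))
  simp only [Finset.mem_filter, Finset.mem_univ, true_and, Finset.filter_filter] at h1
  exact h1

end Fibre

/-! ### §3 Collecting the fixed points of `g` by rotation number (Lemma 2.5, Corollary 2.8) -/

section Collect

variable {M : Type*} [TopologicalSpace M] [ChartedSpace ℂ M] [IsManifold 𝓘(ℂ, ℂ) ω M]
  [CompactSpace M] [T2Space M] [PreconnectedSpace M] [Nonempty M] [Finite (autGroup M)]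
  (G : Subgroup (autGroup M))

open OrbitSurface

open Classical in
/-- **The fixed points of `g ≠ 1` regrouped over the branch values:
`Σ_{P ∈ Fix g} F(a_P(g)) = |C_G(g)| · Σ_{q ∈ Br} r_q⁻¹ · Σ_{y ∈ G_{q.out}, y ∼_G g} F(a_{q.out}(y))`** for every
function `F` of the rotation number («collecting the terms with equal exponent and using the previous lemma»).
[cite: FredianiGhigiPenegini2015, Lemma 2.5, Corollary 2.8] -/
theorem sum_fixedBy_eq_card_centralizer_mul_sum_branch [Fintype ↥G] [DecidableEq ↥G] {g : ↥G} (hg : g ≠ 1)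
    (F : ℂ → ℂ) :
    ∑ P ∈ (finite_fixedBy (M := M) hg).toFinset, F (stabDeriv P g) =
      Nat.card (Subgroup.centralizer {g}) *
        ∑ q ∈ (branchDiv (mk G : M → OrbitSurface G M)).support, (stabOrder q : ℂ)⁻¹ *
          ∑ y ∈ Finset.univ.filter (fun y : ↥G ↦ y • q.out = q.out ∧ IsConj g y), F (stabDeriv q.out y) := by
  set s := (finite_fixedBy (M := M) hg).toFinset with hsdef
  have hmaps : ∀ P ∈ s, mk G P ∈ (branchDiv (mk G : M → OrbitSurface G M)).support := fun P hP ↦ by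
    rw [hsdef, Set.Finite.mem_toFinset, mem_fixedBy] at hP
    exact (mem_support_ramificationDiv_iff_mk_mem_support_branchDiv G P).1
      (mem_support_ramificationDiv_of_smul_eq G hg hP)
  rw [← Finset.sum_fiberwise_of_maps_to hmaps, Finset.mul_sum]
  refine Finset.sum_congr rfl fun q _ ↦ ?_
  have hr : (stabOrder q : ℂ) ≠ 0 := Nat.cast_ne_zero.2 (Nat.one_le_iff_ne_zero.1 (one_le_stabOrder q))
  have hs : ∀ P, mk G P = q → g • P = P → P ∈ s := fun P _ hP ↦ by
    rw [hsdef, Set.Finite.mem_toFinset, mem_fixedBy]; exact hP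
  have key := stabOrder_mul_sum_filter_fixedBy_eq_card_centralizer_mul G g q F s hs
  have hfilt : s.filter (fun P ↦ mk G P = q ∧ g • P = P) = s.filter (fun P ↦ mk G P = q) := by
    refine Finset.filter_congr fun P hP ↦ ⟨fun h ↦ h.1, fun h ↦ ⟨h, ?_⟩⟩
    rw [hsdef, Set.Finite.mem_toFinset, mem_fixedBy] at hP
    exact hP
  rw [hfilt] at key
  rw [← mul_assoc, mul_comm (Nat.card (Subgroup.centralizer {g}) : ℂ), mul_assoc, ← key, ← mul_assoc,
    inv_mul_cancel₀ hr, one_mul]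

open Classical in
/-- **LEMMA 2.5: `|Fix_ζ(g)| = |C_G(g)| · Σ_{t : ∃ y ∈ G_{P_t}, y ∼_G g, a_{P_t}(y) = ζ} 1/m_t`** — the number of
fixed points of `g ≠ 1` with rotation number `ζ`; over the branch value `q_t` at most one `y ∈ G_{P_t}` has
`a_{P_t}(y) = ζ` (`a_{P_t}` is injective), the printed `x_i^{m_i ν/m}` for `ζ = ζ_m^ν`.
[cite: FredianiGhigiPenegini2015, Lemma 2.5] -/
theorem card_fixedBy_stabDeriv_eq [Fintype ↥G] [DecidableEq ↥G] {g : ↥G} (hg : g ≠ 1) (ζ : ℂ) :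
    (((finite_fixedBy (M := M) hg).toFinset.filter fun P ↦ stabDeriv P g = ζ).card : ℂ) =
      Nat.card (Subgroup.centralizer {g}) *
        ∑ q ∈ (branchDiv (mk G : M → OrbitSurface G M)).support.filter
            (fun q ↦ ∃ y : ↥G, y • q.out = q.out ∧ IsConj g y ∧ stabDeriv q.out y = ζ),
          (stabOrder q : ℂ)⁻¹ := by
  have h1 := sum_fixedBy_eq_card_centralizer_mul_sum_branch G hg (fun z ↦ if z = ζ then 1 else 0)
  rw [← Finset.sum_filter, Finset.sum_const, nsmul_eq_mul, mul_one] at h1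
  rw [h1, Finset.sum_filter]
  congr 1
  refine Finset.sum_congr rfl fun q _ ↦ ?_
  -- the inner sum is `1` or `0`: at most one `y ∈ G_{q.out}` has rotation number `ζ`
  rw [← Finset.sum_filter, Finset.filter_filter, Finset.sum_const, nsmul_eq_mul, mul_one]
  have hle : (Finset.univ.filter fun y : ↥G ↦ (y • q.out = q.out ∧ IsConj g y) ∧ stabDeriv q.out y = ζ).card ≤ 1 := by
    rw [Finset.card_le_one]
    intro a ha b hb
    simp only [Finset.mem_filter, Finset.mem_univ, true_and] at ha hb
    have hinj := stabDerivHom_injective hhol_of_holomorphicSMul (H := ↥G) (P := q.out)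
    have hab : stabDerivHom hhol_of_holomorphicSMul q.out ⟨a, mem_stabilizer_iff.2 ha.1.1⟩ =
        stabDerivHom hhol_of_holomorphicSMul q.out ⟨b, mem_stabilizer_iff.2 hb.1.1⟩ := by
      rw [stabDerivHom_apply, stabDerivHom_apply]
      exact ha.2.trans hb.2.symm
    exact congrArg Subtype.val (hinj hab)
  by_cases hex : ∃ y : ↥G, y • q.out = q.out ∧ IsConj g y ∧ stabDeriv q.out y = ζ
  · obtain ⟨y, hy⟩ := hex
    have hmem : y ∈ Finset.univ.filter fun y : ↥G ↦ (y • q.out = q.out ∧ IsConj g y) ∧ stabDeriv q.out y = ζ := by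
      simp only [Finset.mem_filter, Finset.mem_univ, true_and]; exact ⟨⟨hy.1, hy.2.1⟩, hy.2.2⟩
    have hcard : (Finset.univ.filter fun y : ↥G ↦ (y • q.out = q.out ∧ IsConj g y) ∧ stabDeriv q.out y = ζ).card = 1 :=
      le_antisymm hle (Finset.card_pos.2 ⟨y, hmem⟩)
    rw [hcard, if_pos ⟨y, hy⟩, Nat.cast_one, mul_one]
  · have hcard : (Finset.univ.filter fun y : ↥G ↦ (y • q.out = q.out ∧ IsConj g y) ∧ stabDeriv q.out y = ζ).card = 0 := by
      rw [Finset.card_eq_zero, Finset.filter_eq_empty_iff]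
      intro y _ hy
      exact hex ⟨y, hy.1.1, hy.1.2, hy.2⟩
    rw [hcard, if_neg hex, Nat.cast_zero, mul_zero]

open Classical in
/-- **The number of fixed points of `g ≠ 1`: `|Fix g| = |C_G(g)| · Σ_{q ∈ Br} #{y ∈ G_{q.out} : y ∼_G g}/r_q`.**
[cite: FredianiGhigiPenegini2015, Lemma 2.5 (summed over `ν`)] -/
theorem ncard_fixedBy_eq_card_centralizer_mul_sum [Fintype ↥G] [DecidableEq ↥G] {g : ↥G} (hg : g ≠ 1) :
    ((fixedBy M g).ncard : ℂ) =
      Nat.card (Subgroup.centralizer {g}) *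
        ∑ q ∈ (branchDiv (mk G : M → OrbitSurface G M)).support, (stabOrder q : ℂ)⁻¹ *
          ((Finset.univ.filter fun y : ↥G ↦ y • q.out = q.out ∧ IsConj g y).card : ℂ) := by
  have h1 := sum_fixedBy_eq_card_centralizer_mul_sum_branch G hg (fun _ ↦ 1)
  simp only [Finset.sum_const, nsmul_eq_mul, mul_one] at h1
  rw [Set.ncard_eq_toFinset_card _ (finite_fixedBy hg), h1]

open Classical in
/-- **COROLLARY 2.8 (Eichler's formula in terms of the branch data):** for `g ≠ 1` in `G ≤ Aut M` (`Aut M` finite),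
`tr(g|𝓗¹(M)) = 1 + |C_G(g)| · Σ_{q ∈ Br} r_q⁻¹ · Σ_{y ∈ G_{q.out}, y ∼_G g} a(y)⁻¹/(1 − a(y)⁻¹)`
(`a_P(g⁻¹) = a_P(g)⁻¹`; the printed form lists `ζ_m^ν/(1 − ζ_m^ν)` weighted by `|Fix_ν|`).
[cite: FredianiGhigiPenegini2015, Corollary 2.8, Theorem 2.7] [cite: FarkasKra1992, V.2.9 Theorem] -/
theorem trace_oneFormRep_eq_one_add_card_centralizer_mul_sum [Fintype ↥G] [DecidableEq ↥G] {g : ↥G} (hg : g ≠ 1) :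
    LinearMap.trace ℂ ↥(holomorphicOneForms M) (oneFormRep M (g : autGroup M)) =
      1 + Nat.card (Subgroup.centralizer {g}) *
        ∑ q ∈ (branchDiv (mk G : M → OrbitSurface G M)).support, (stabOrder q : ℂ)⁻¹ *
          ∑ y ∈ Finset.univ.filter (fun y : ↥G ↦ y • q.out = q.out ∧ IsConj g y),
            (stabDeriv q.out y)⁻¹ / (1 - (stabDeriv q.out y)⁻¹) := by
  have hg' : (g : autGroup M) ≠ 1 := fun h1 ↦ hg (OneMemClass.coe_eq_one.1 h1)
  rw [trace_oneFormRep_eq_one_add_sum hg']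
  congr 1
  have h1 := sum_fixedBy_eq_card_centralizer_mul_sum_branch G hg (fun z ↦ z⁻¹ / (1 - z⁻¹))
  have h2 : ∑ P ∈ (finite_fixedBy (M := M) hg').toFinset,
      stabDeriv P ((g : autGroup M))⁻¹ / (1 - stabDeriv P ((g : autGroup M))⁻¹) =
      ∑ P ∈ (finite_fixedBy (M := M) hg).toFinset, (stabDeriv P g)⁻¹ / (1 - (stabDeriv P g)⁻¹) := by
    refine Finset.sum_congr (by ext P; simp only [Set.Finite.mem_toFinset, mem_fixedBy]; rfl) fun P hP ↦ ?_
    rw [Set.Finite.mem_toFinset, mem_fixedBy] at hP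
    have hP' : g • P = P := hP
    rw [← Subgroup.coe_inv, show stabDeriv P ((g⁻¹ : ↥G) : autGroup M) = stabDeriv P (g⁻¹ : ↥G) from rfl,
      stabDeriv_inv hhol_of_holomorphicSMul hP']
  rw [h2, h1]

end Collect

end RiemannSurface

end Literature.Geometry.Kaehler

end
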